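import Mathlib
import Literature.Topology.FourManifolds.TwistedSpheres
import Literature.Topology.FourManifolds.Isotopy
import HarnessLib

/-!
# Named fact: Cerf's theorem `Γ₄ = 0` in twisted-sphere form

Grounder file (D-0014 named facts) for the route `SmoothPoincare4/SchoenfliesSplit` (assembly item
stmt-SmoothPoincare4-0517 takes this fact verbatim as its hypothesis `h₁`; crux
stmt-SmoothPoincare4-0516 is "every homotopy 4-sphere is a twisted sphere").

Cerf (1968) proved `Γ₄ = 0`: every orientation-preserving diffeomorphism of `S³` is
pseudo-isotopic to the identity (indeed extends over `D⁴`), so every twisted 4-sphere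
`Σ(φ) = D⁴ ∪_φ D⁴` is diffeomorphic to `S⁴` (Kervaire–Milnor 1963, §1: `Σ(φ)` depends only on the
pseudo-isotopy class of `φ`, and `Σ(id) = S⁴`). For orientation-reversing `φ` the same conclusion
holds after composing with a reflection of one disc, which extends over that disc. (Hatcher's proof
of the Smale conjecture, Ann. of Math. 117 (1983), `Diff(S³) ≃ O(4)`, reproves this.) The statement
below quantifies over ALL diffeomorphisms `φ` of the unit sphere `S³ ⊂ ℝ⁴` and over all bundled
twisted spheres `T : Literature.TwistedSphere 3 φ` (`TwistedSpheres.lean`), concluding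
`T.carrier ≅ S⁴ ⊂ ℝ⁵`. The instance binder `[Fact (Literature.isSmoothEmbedding_sphereInclusion' 3)]` is
the tree's convention for `closedBallBoundaryData` (`ClosedBall.lean`).

Nothing is asserted; users take `(h : Literature.cerf_twistedSphere_four)`.

## References

* J. Cerf, *Sur les difféomorphismes de la sphère de dimension trois (Γ₄ = 0)*, Lecture Notes in
  Mathematics 53, Springer (1968), main theorem (Γ₄ = 0).
* M. Kervaire, J. Milnor, *Groups of homotopy spheres I*, Ann. of Math. 77 (1963), §1.
-/

noncomputable section

open scoped Manifold ContDiff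

namespace Literature.Topology.FourManifolds

/-- NAMED FACT (Cerf 1968, main theorem `Γ₄ = 0`; with Kervaire–Milnor 1963 §1). Every twisted
4-sphere `D⁴ ∪_φ D⁴`, `φ` any self-diffeomorphism of `S³`, is diffeomorphic to the standard `S⁴`.
Users take `(h : cerf_twistedSphere_four)`.
[cite: Cerf1968, main theorem (Γ₄ = 0)] [cite: KervaireMilnor1963, §1] -/
def cerf_twistedSphere_four : Prop :=
  ∀ [Fact (Literature.Topology.FourManifolds.isSmoothEmbedding_sphereInclusion' 3)]
    (φ : (Metric.sphere (0 : EuclideanSpace ℝ (Fin 4)) 1) ≃ₘ⟮𝓡 3, 𝓡 3⟯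
      (Metric.sphere (0 : EuclideanSpace ℝ (Fin 4)) 1))
    (T : Literature.Topology.FourManifolds.TwistedSphere 3 φ),
    Nonempty (T.carrier ≃ₘ⟮𝓡 4, 𝓡 4⟯ Metric.sphere (0 : EuclideanSpace ℝ (Fin 5)) 1)

/-- NAMED FACT (Cerf 1968, main theorem: `π₀ Diff⁺(S³) = 0`, i.e. `Diff(S³)` has exactly the two
isotopy classes given by orientation) in a boundary-free, orientation-free phrasing over
`Isotopy.lean`: among any three self-diffeomorphisms of `S³`, two are smoothly isotopic
(`π₀ Diff(S³)` has at most two elements). Requested alternative form for route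
SmoothPoincare4/SchoenfliesSplit (`wi-03942`); the twisted-sphere consequence is
`cerf_twistedSphere_four` above. [cite: Cerf1968, main theorem (π₀ Diff⁺ S³ = 0)] -/
def cerf_isotopy_sphere_three : Prop :=
  ∀ (φ ψ χ : (Metric.sphere (0 : EuclideanSpace ℝ (Fin 4)) 1) ≃ₘ⟮𝓡 3, 𝓡 3⟯
      (Metric.sphere (0 : EuclideanSpace ℝ (Fin 4)) 1)),
    Literature.Topology.FourManifolds.IsSmoothlyIsotopic (𝓡 3) (𝓡 3) ⇑φ ⇑ψ ∨ Literature.Topology.FourManifolds.IsSmoothlyIsotopic (𝓡 3) (𝓡 3) ⇑ψ ⇑χ ∨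
      Literature.Topology.FourManifolds.IsSmoothlyIsotopic (𝓡 3) (𝓡 3) ⇑φ ⇑χ

end Literature.Topology.FourManifolds

end
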